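import Summits.HodgeConjecture.HodgeConjecture.Theorems.F0P3KitOfRecordLawsV8             -- ★ p825117 (+ cone: ★ K0 `F0P3KitOfRecord` — `GHSide`, `kitOfRecord`, `rfl` read-backs; ★ V8-B laws `MatchingS`, `TransferS`)
import Summits.HodgeConjecture.HodgeConjecture.Theorems.F0P3SemilocalTestFunctionsOfRecord   -- ★ p821569: `TestS₀`, `tens₀`, `tens₀_smooth`
import HarnessLib

/-!
# `F0P3GHSideOfFibres` — (K9-0a)(a) «THE G∕H-SIDE `S`-CARRIERS OF RECORD, BUILT FROM THE KIT'S OWN FIBRES» + K9-1 BY CONSTRUCTION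

Cell `hodgecm-mathlib`, F0∕P3 «U3-mult», crux H413 (`stmt-HodgeConjecture-24833`); seat F0P3-p04 (g9) («K9β» closer lineage; ★ K0 `F0P3KitOfRecord` is this lineage's
text).  F0P3-plan (g7) PROVISIONAL RULING 23:43:36Z (1) on F0P3a-p01 (g10)'s CENSUS «K9-0» (`F0/P3a/F0P3a-p01/g10/CENSUS-K9-0-packet-data.F0P3a-p01g10.md` 3922191a):
«(K9-0a) GO — M, unblocked: … `gh` by the closer's own recipe :862–:873 …»; ROAD MEMO `ROADMEMO-rung0-nine-letters.F0P3a-p01g10.md` §3 (K9-1 = «`matchingS`∕`transferS`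
hold BY CONSTRUCTION»).  ONE honest `def` + theorems; no instance, no notation, no `sorry`, no named fact; count-neutral (nothing here is a printed statement — it is
the bookkeeping [Rogawski1990 §14.2 (14.2.1) p. 232, §14.3] that a matching triple `(f′, f, f^H)` is «`f′` together with the partners T1g chooses»).
HONEST LABEL: HC_CM is proved only modulo the printed citations until rung 0 closes.

WHY SOCKET-LEVEL.  The K9β closer's `OverrideWitness … 𝔨` (`Cruxes/H413/Lines/F0_U3LettersRung1.lean` §B) posits `gh : GHSide L H ι T hT ov.PacketG ov.PacketH` and,
inside `specPkg : SpecPkg (kitK9 … ov gh …) S₀`, the two laws `matchingS`∕`transferS` about it — its docstring (:862–:873 of ED. 13; «`TestSG S = TestSH S := TestS₀ S`,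
`tensG ∕ tensH` := the partners law T1g `TransferExistence` chooses, `MatchesS S fS fSG fSH := fSG = fS ∧ fSH = fS`, so `matchingS` ∕ `transferS` hold by construction»)
describes a TERM that was never written.  `ComparisonKit` lives in a Lines file, so no Theorems module may mention `𝔨`; but everything the recipe uses is SOCKET data
(★ V6 `Sockets L H μ`: `Smooth`, `Matches`, `PacketG`, `PacketH`) — and at the closer `𝔰 := socketsOfT1 (𝔨.override ov)` has `𝔰.Smooth = 𝔨.Smooth`,
`𝔰.Matches = 𝔨.Matches` by `rfl`, T1g `𝔨.TransferExistence` IS the hypothesis `hg`, and T1's pin (iv) «`Smooth f′ ↔ ∃ T, T.IsTest ∧ ⇑f′ = T.eval`» with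
★ `tens₀_smooth` gives `hsm`.  Hence this file, typed over `𝔰`, is what a later closer edition instantiates to turn `specPkg.matchingS`∕`.transferS` into theorems.

Contents (all proved; axioms TRIO):
* hypotheses (inline, no `Prop` defs): `hg` = T1g at the socket level («every `𝔰.Smooth` `f′` has a matching pair»), `hsm` = the record tensors `tens₀ S fS fT` are `𝔰.Smooth`.
* **`ghOfFibres 𝔰 hg hsm trGS trHS : GHSide L H ι T hT 𝔰.PacketG 𝔰.PacketH`** — `TestSG = TestSH := TestS₀`; `tensG S fS fT`, `tensH S fS fT` := the partners `hg` chooses for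
  `tens₀ S fS fT` (`Classical.choose`); `trGS`, `trHS` as given (the genuine `S`-level packet traces stay PARAMETERS — K9-3∕4∕5's content); `MatchesS S fS fSG fSH := fSG = fS ∧ fSH = fS`.
* `matches_tensG_tensH` — `𝔰.Matches (tens₀ S fS fT) (gh.tensG S fS fT) (gh.tensH S fS fT)` (`choose_spec`).
* **`matchingS_kitOfRecord_ghOfFibres`** — V8 law `MatchingS S₀` at `kitOfRecord … 𝔰 (ghOfFibres …) …`, for EVERY `S₀` and every other kit parameter (K9-1a).
* **`transferS_kitOfRecord_ghOfFibres`** — V8 law `TransferS S₀` likewise (K9-1b): the partners of `fS` are `(fS, fS)`.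

## References
* [Rogawski1990] J. D. Rogawski, *Automorphic Representations of Unitary Groups in Three Variables*, Ann. of Math. Stud. 123 (1990): §14.2 (14.2.1) p. 232 and p. 233
  («from now on, `f_v` will denote a function that corresponds to `f′_v`»); §14.3 pp. 233–234; §4.9 Prop. 4.9.1 p. 55; Thm. 14.6.1 p. 241.
* [LanglandsShelstad1987] R. P. Langlands, D. Shelstad, *On the definition of transfer factors*, Math. Ann. 278 (1987), §1.3–1.4 (the notion of matching functions).
-/

set_option autoImplicit false
set_option linter.dupNamespace false

noncomputable section

open NumberField IsDedekindDomain MeasureTheory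
open Literature.NumberTheory.Rogawski1990 Literature.NumberTheory.GaloisRepresentations
open Literature.NumberTheory.Automorphic Literature.NumberTheory.Automorphic.UnitaryGroup
open scoped Matrix

namespace Summit.HodgeConjecture.HodgeConjecture.Cruxes.H413.F0P3GHSideOfFibres

open Summit.HodgeConjecture.HodgeConjecture.Cruxes.H413.F0P3InnerFormClassificationV6 (Gp Places Cinf Sockets TestGp TestG TestH)
open Summit.HodgeConjecture.HodgeConjecture.Cruxes.H413.F0P3KitOfRecord (GHSide XiSide kitOfRecord)
open Summit.HodgeConjecture.HodgeConjecture.Cruxes.H413.F0P3TestFunctionsOfRecord (Unr₀)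
open Summit.HodgeConjecture.HodgeConjecture.Cruxes.H413.F0P3SemilocalTestFunctionsOfRecord (TestS₀ tens₀ tens₀_smooth)

variable (L : Type) [Field L] [NumberField L] [IsCMField L] (H : Matrix (Fin 3) (Fin 3) L) (ι : L →+* ℂ) (T : GL (Fin 3) ℂ)
  (hT : (T : Matrix (Fin 3) (Fin 3) ℂ)ᴴ * H.map ι * (T : Matrix (Fin 3) (Fin 3) ℂ) = Literature.Geometry.ComplexHyperbolic.BallModel.J)
  (μ : Measure (Gp L H).automorphicQuotient) [(Gp L H).IsAutomorphicMeasure μ]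

/-! ## §1 The two socket-level hypotheses the closer supplies — spelled INLINE (no `Prop` definitions):
`hg : ∀ f′, 𝔰.Smooth f′ → ∃ f fH, 𝔰.Matches f′ f fH` (T1g at the socket level [Rogawski1990 §14.2 p. 233; §14.3; Prop. 4.9.1]; at the closer = `𝔨.TransferExistence`
verbatim through `socketsOfT1` ∕ `override_transferExistence_iff`) and `hsm : ∀ S fS fT, 𝔰.Smooth (tens₀ S fS fT)` (the record tensors are smooth in the socket's sense;
at a T1-PINNED kit = pin (iv) «`Smooth f′ ↔ ∃ T, T.IsTest ∧ ⇑f′ = T.eval`» + ★ `tens₀_smooth`). -/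

/-! ## §2 The G∕H-side carriers of record -/

variable {L H μ} in
/-- **`ghOfFibres 𝔰 hg hsm trGS trHS` — THE G∕H-SIDE `S`-CARRIERS BUILT FROM THE KIT'S OWN FIBRES** (the K9β closer's recipe, ED. 13 :862–:873, as a term): `S`-level test data on
`G` and on `H` ARE the `G′`-side data (`TestSG S = TestSH S := TestS₀ … S`); the tensors `f := tensG S f′_S f^S`, `f^H := tensH S f′_S f^S` are the MATCHING PARTNERS that T1g
(`hg`) chooses for the record tensor `f′ = tens₀ S f′_S f^S` (smooth by `hsm`) — «from now on, `f_v` will denote a function that corresponds to `f′_v`» [Rogawski1990 §14.2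
p. 233]; the `S`-level matching relation is EQUALITY of the `G′`-side data (`MatchesS S fS fSG fSH := fSG = fS ∧ fSH = fS`); the `S`-level packet traces `trGS`, `trHS`
stay parameters (their identification with print's `Tr Π_S(f_S)`, `Tr ρ_S(f^H_S)` is the content of the laws `FactorisationPk`∕`APacketSpectral`∕`LocalExpansion`, not of
this file; no packet index is baked in — LEAD F0P3a-plan (g8) T7-4 (C)(i)).  CAUTION (T7-4 (C)(ii)): `TestSG S = TestSH S := TestS₀ … S` does NOT identify the semilocal Hecke
algebras of `G` and `H` with `G′`'s — the `S`-level data are mere INDICES for the chosen partners (which live in T1's `TestG L` ∕ `TestH L`), and `MatchesS` is equality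
of those indices with the record `fS` on both sides. [cite: Rogawski1990, §14.2 (14.2.1) p. 232 and p. 233; §14.3 pp. 233–234] [cite: LanglandsShelstad1987, §1.3–1.4] -/
def ghOfFibres (𝔰 : Sockets L H μ) (hg : ∀ f' : TestGp L H, 𝔰.Smooth f' → ∃ (f : TestG L) (fH : TestH L), 𝔰.Matches f' f fH)
    (hsm : ∀ (S : Finset (Places L)) (fS : TestS₀ L H ι T hT S) (fT : Unr₀ L H S), 𝔰.Smooth (tens₀ S fS fT))
    (trGS : ∀ S : Finset (Places L), 𝔰.PacketG → TestS₀ L H ι T hT S → ℂ) (trHS : ∀ S : Finset (Places L), 𝔰.PacketH → TestS₀ L H ι T hT S → ℂ) :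
    GHSide L H ι T hT 𝔰.PacketG 𝔰.PacketH where
  TestSG := TestS₀ L H ι T hT
  TestSH := TestS₀ L H ι T hT
  tensG := fun S fS fT => (hg _ (hsm S fS fT)).choose
  tensH := fun S fS fT => (hg _ (hsm S fS fT)).choose_spec.choose
  trGS := trGS
  trHS := trHS
  MatchesS := fun _ fS fSG fSH => fSG = fS ∧ fSH = fS

variable {L H μ}
variable (𝔰 : Sockets L H μ) (hg : ∀ f' : TestGp L H, 𝔰.Smooth f' → ∃ (f : TestG L) (fH : TestH L), 𝔰.Matches f' f fH)
  (hsm : ∀ (S : Finset (Places L)) (fS : TestS₀ L H ι T hT S) (fT : Unr₀ L H S), 𝔰.Smooth (tens₀ S fS fT))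
  (trGS : ∀ S : Finset (Places L), 𝔰.PacketG → TestS₀ L H ι T hT S → ℂ) (trHS : ∀ S : Finset (Places L), 𝔰.PacketH → TestS₀ L H ι T hT S → ℂ)

/-- Read-back: the `S`-level test data on `G` are the `G′`-side data. -/
theorem ghOfFibres_TestSG (S : Finset (Places L)) : (ghOfFibres ι T hT 𝔰 hg hsm trGS trHS).TestSG S = TestS₀ L H ι T hT S := rfl

/-- Read-back: the `S`-level test data on `H` are the `G′`-side data. -/
theorem ghOfFibres_TestSH (S : Finset (Places L)) : (ghOfFibres ι T hT 𝔰 hg hsm trGS trHS).TestSH S = TestS₀ L H ι T hT S := rfl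

/-- Read-back: `S`-level matching is equality of the `G′`-side data. -/
theorem ghOfFibres_matchesS_iff (S : Finset (Places L)) (fS fSG fSH : TestS₀ L H ι T hT S) :
    (ghOfFibres ι T hT 𝔰 hg hsm trGS trHS).MatchesS S fS fSG fSH ↔ fSG = fS ∧ fSH = fS := Iff.rfl

/-- **The chosen partners match the record tensor**: `𝔰.Matches (f′_{S,∞} ⊗ f^S) (tensG S f′_S f^S) (tensH S f′_S f^S)` (T1g's `choose_spec`).
[cite: Rogawski1990, §14.2 (14.2.1) p. 232; §14.3 pp. 233–234] -/
theorem matches_tensG_tensH (S : Finset (Places L)) (fS : TestS₀ L H ι T hT S) (fT : Unr₀ L H S) :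
    𝔰.Matches (tens₀ S fS fT) ((ghOfFibres ι T hT 𝔰 hg hsm trGS trHS).tensG S fS fT) ((ghOfFibres ι T hT 𝔰 hg hsm trGS trHS).tensH S fS fT) :=
  (hg _ (hsm S fS fT)).choose_spec.choose_spec

/-! ## §3 K9-1 BY CONSTRUCTION — the v8 laws `MatchingS S₀` and `TransferS S₀` at the kit of record with `gh := ghOfFibres …` -/

variable [MeasurableSpace (Gp L H).Adelic] [BorelSpace (Gp L H).Adelic]
variable (ξd : XiSide L H 𝔰.PacketG 𝔰.PacketH) (μω : HeckeCharacter L) (c : ℚ) (jInf dsInf : ℤ → ℤ → ℤ → Cinf)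
  (archTr : Cinf → (UnitaryGroup.arch (↥(maximalRealSubfield L)) L (IsCMField.complexConj L) 3 H → ℂ) → ℂ)
  (ν : Measure (Gp L H).Adelic) [IsFiniteMeasureOnCompacts ν]
  (μv : ∀ v : Places L, @Measure ((cmDatum L 3 H).Local v) (borel _))
  (ramCls₀ : DiscreteAutomorphicRep (Gp L H) μ → Set (Places L))

/-- **K9-1a — `MatchingS S₀` HOLDS BY CONSTRUCTION at `kitOfRecord … 𝔰 (ghOfFibres …) …`** (for EVERY `S₀`): `S`-level matching data `(fS, fSG, fSH)` mean `fSG = fS = fSH`, the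
record tensor `tens₀ S fS fT` is smooth (`hsm`), and its chosen partners match it (`matches_tensG_tensH`). [cite: Rogawski1990, §14.2 (14.2.1) p. 232; §14.3] -/
theorem matchingS_kitOfRecord_ghOfFibres (S₀ : Finset (Places L)) :
    F0P3InnerFormClassificationV8.ClassificationKit.MatchingS
      (kitOfRecord L H ι T hT μ 𝔰 (ghOfFibres ι T hT 𝔰 hg hsm trGS trHS) ξd μω c jInf dsInf archTr ν μv ramCls₀) S₀ := by
  intro S fS fSG fSH fT _ hm
  obtain ⟨h1, h2⟩ := hm
  rw [h1, h2]
  exact ⟨hsm S fS fT, matches_tensG_tensH ι T hT 𝔰 hg hsm trGS trHS S fS fT⟩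

/-- **K9-1b — `TransferS S₀` HOLDS BY CONSTRUCTION at `kitOfRecord … 𝔰 (ghOfFibres …) …`** (for EVERY `S₀`): the `S`-level partners of `fS` are `(fS, fS)`.
[cite: Rogawski1990, §14.2 p. 233; §14.3 pp. 233–234] -/
theorem transferS_kitOfRecord_ghOfFibres (S₀ : Finset (Places L)) :
    F0P3InnerFormClassificationV8.ClassificationKit.TransferS
      (kitOfRecord L H ι T hT μ 𝔰 (ghOfFibres ι T hT 𝔰 hg hsm trGS trHS) ξd μω c jInf dsInf archTr ν μv ramCls₀) S₀ :=
  fun _ _ fS => ⟨fS, fS, rfl, rfl⟩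

end Summit.HodgeConjecture.HodgeConjecture.Cruxes.H413.F0P3GHSideOfFibres

end
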